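import Literature.AnabelianGeometry.EtaleTheta.Discharge.Sec2ClassTwoCommutators
import Literature.AnabelianGeometry.EtaleTheta.DoubleUnderline
import Literature.AnabelianGeometry.EtaleTheta.SettingCompletion
import HarnessLib

/-!
# [EtTh] Prop 2.12 (i): the commutator structure of the theta group over the §1 setting
# (proof-only companion; abc-iut-L2-t10's hypothesis `hcomm` for the §1 model)

Mochizuki, *The étale theta function and its Frobenioid-theoretic manifestations*, Publ. RIMS **45**
(2009) [EtTh], §1 PRIMS PDF pp. 12–13 and §2 Prop. 2.12 (i) p. 45 (locators `p.N` = PDF pages; bib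
key `MochizukiEtTh2009`).  Layer L2 of the abc-iut cell, item N8 of abc-iut-L2-t8's adapter report
(`hcomm`), seat abc-iut-L5-t14 (cross-layer).  PROOF-ONLY: no definition, no statement of seats
t1/t2/t8/t10 is edited or restated.

p. 12: "Since `Δ_X` is a profinite free group on 2 generators, we also have a natural exact sequence
`1 → ∧² Δ^ell_X (≅ Ẑ(1)) → Δ^Θ_X → Δ^ell_X → 1` — where we write `Δ^Θ_X := Δ_X/[Δ_X,[Δ_X,Δ_X]]`";
pp. 12–13: "we have a natural exact sequence of abelian profinite groups
`1 → Δ_Θ → (Δ^tp_Y)^Θ → (Δ^tp_Y)^ell → 1`"; p. 45 (proof of Prop. 2.12): "it follows from the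
well-known structure of the theta-group (`= Δ^Θ_C[μ_N]`)".

WHAT IS PROVED.  For a theta setting `D : ThetaSetting p` (root file `Setting.lean`) write
`Π = Π^tp_X`, `Δ = Δ^tp_X = Ker(aug)`, `ι : Π → Π_X` the profinite completion, `Δ_X = D.DeltaHat`,
`K₂ = [Δ_X,Δ_X]⁻`, `K₃ = [[Δ_X,Δ_X],Δ_X]⁻`, `θ : Π ↠ (Π^tp_X)^Θ` with `Ker θ = ι⁻¹ K₃`.

* `ThetaSetting.exists_commutator_of_mem_deltaTheta` — the HEISENBERG SURJECTIVITY of the theta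
  group: for every `z₁ ∈ Δ^tp_X` generating `Z = Δ^tp_X/Δ^tp_Y` (`toZ z₁ = 1`), every element of
  `Δ_Θ = Ker((Π^tp_X)^Θ ↠ (Π^tp_X)^ell)` is `θ[z₁, y]` for some `y ∈ Δ^tp_Y`;
* `ThetaSetting.EtaleThetaData.DoubleUnderline.exists_commutator_of_mem_lDeltaTheta` — for the
  covering `X̲̲` (`C : E.DoubleUnderline l`): every `t ∈ Π^tp_X̲̲` with `θ t ∈ l·Δ_Θ` is
  `t = z b z⁻¹ b⁻¹ k` with `z ∈ Δ^tp_X̲̲`, `b ∈ Δ^tp_Y̲̲`, `θ k = 1` — the `⊆` half of abc-iut-L2-t10's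
  `hcomm` (the `⊇` half is abc-iut-L2-t8's `commutator_mem_comap_lDeltaTheta`);
both MODULO the printed p. 12–13 sentence "(Δ^tp_Y)^Θ is an ABELIAN PROFINITE group", carried as
two explicit hypotheses because `Setting.lean` (v3) records `(Δ^tp_Y)^Θ` only through indices:
`hYab : (Δ^tp_Y)^Θ is commutative` and `hYcl : the image of Δ^tp_Y in Δ^Θ_X = Δ_X/K₃ is closed`
(`(ι Δ^tp_Y)⁻ ≤ ι Δ^tp_Y ⊔ K₃`), and (for the second) the vacuity guard `D.IsEtThOrigin` ("`Δ_X` is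
a profinite free group on 2 generators", used through ONE finite Heisenberg quotient
`Δ_X → H(ℤ/lℤ)` to see `[Δ_Θ : l·Δ_Θ] ≥ l`).

PROOF (classical profinite group theory, no freeness needed for the first theorem): in the class-2
quotient `Π_X/K₃` the commutator is bilinear on `Δ_X` with central values; `N := (ι Δ^tp_Y)⁻` is
abelian mod `K₃` (`hYab` + continuity), `ι Δ^tp_X ⊆ ι(z₁)^ℤ · N` is dense in `Δ_X`, and the set
`{[ι z₁, n]·k : n ∈ N, k ∈ K₃}` is a CLOSED (compact) SUBGROUP containing every `[t, t']`,
`t, t' ∈ ι Δ^tp_X`, hence (density, continuity) `[Δ_X, Δ_X]` and `K₂`; `hYcl` turns `n` into an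
element of `Δ^tp_Y`.  The `l`-bookkeeping of the second theorem: `[Δ^tp_Y : Δ^tp_Y̲̲] = l`
(`relIndex_Huu_GtpY` + `map_aug_Ydduu`), `θ(Π^tp_X̲̲) ∩ Δ_Θ = l·Δ_Θ` (`map_toTheta_Huu`) and
`[Δ_Θ : l·Δ_Θ] ≥ l` force `Δ^tp_Y = Δ^tp_Y̲̲ · θ⁻¹(Δ_Θ)`, and `θ[z₀, θ⁻¹(Δ_Θ)] = 1`.

HONEST FRAMING: [EtTh] is refereed; the theta setting is data quoting print and is not asserted to
exist; nothing here takes a side on any disputed claim; typed ≠ discharged for the two hypotheses,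
which are exactly the p. 12–13 sentence and are the candidate root axioms reported to abc-iut-L2-t1.
-/

noncomputable section

namespace Literature.AnabelianGeometry.EtaleTheta

open Literature.AnabelianGeometry.SemiGraphs
open _root_.Topology
open scoped commutatorElement
open ClassTwo

/-! ### The theta setting: a finite quotient from freeness; Heisenberg surjectivity onto `Δ_Θ` -/

namespace ThetaSetting

variable {p : ℕ} [Fact p.Prime] (D : ThetaSetting p)

variable {D} in
/-- "`Δ_X` is a profinite free group on 2 generators" (p. 12, the guard `IsEtThOrigin`) supplies,
for every FINITE group `Q` and `x, y ∈ Q`, a homomorphism `F : Δ_X → Q` with `F a = x`, `F b = y`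
for some `a, b ∈ Δ_X`, continuous for the discrete topology on `Q` and therefore carrying the CLOSED
commutator subgroups `[Δ_X,Δ_X]⁻`, `[[Δ_X,Δ_X],Δ_X]⁻` into `[Q,Q]`, `[[Q,Q],Q]`.
[cite: MochizukiEtTh2009, §1 p.12] -/
theorem IsEtThOrigin.exists_hom_finite (hO : D.IsEtThOrigin) (Q : Type) [Group Q] [Finite Q]
    (x y : Q) :
    ∃ (F : D.DeltaHat →* Q) (a b : D.DeltaHat), F a = x ∧ F b = y ∧
      (∀ g : D.DeltaHat, (g : D.PiHat) ∈ (⁅D.DeltaHat, D.DeltaHat⁆).topologicalClosure →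
        F g ∈ (⁅(⊤ : Subgroup Q), (⊤ : Subgroup Q)⁆ : Subgroup Q)) ∧
      (∀ g : D.DeltaHat,
        (g : D.PiHat) ∈ (⁅⁅D.DeltaHat, D.DeltaHat⁆, D.DeltaHat⁆).topologicalClosure →
          F g ∈ (⁅⁅(⊤ : Subgroup Q), (⊤ : Subgroup Q)⁆, (⊤ : Subgroup Q)⁆ : Subgroup Q)) := by
  obtain ⟨_, _, _, a, b, huniv⟩ := hO.deltaHat_free
  letI : TopologicalSpace Q := ⊥
  haveI : DiscreteTopology Q := ⟨rfl⟩
  obtain ⟨f, ⟨hfa, hfb⟩, -⟩ := huniv Q x y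
  have hΔclosed : IsClosed (D.DeltaHat : Set D.PiHat) := Subgroup.isClosed_topologicalClosure _
  have hfc : Continuous f.toMonoidHom := f.continuous_toFun
  -- `[Δ_X, Δ_X]⁻ ⊆ f⁻¹ [Q, Q]`
  have h2 : (⁅D.DeltaHat, D.DeltaHat⁆).topologicalClosure ≤
      ((⁅(⊤ : Subgroup Q), (⊤ : Subgroup Q)⁆ : Subgroup Q).comap f.toMonoidHom).map
        D.DeltaHat.subtype := by
    refine Subgroup.topologicalClosure_minimal _ (Subgroup.commutator_le.mpr ?_)
      (isClosed_map_subtype_comap hΔclosed f.toMonoidHom hfc _)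
    intro g₁ hg₁ g₂ hg₂
    refine ⟨⁅(⟨g₁, hg₁⟩ : D.DeltaHat), ⟨g₂, hg₂⟩⁆, ?_, rfl⟩
    rw [SetLike.mem_coe, Subgroup.mem_comap, map_commutatorElement]
    exact Subgroup.commutator_mem_commutator (Subgroup.mem_top (f.toMonoidHom ⟨g₁, hg₁⟩))
      (Subgroup.mem_top (f.toMonoidHom ⟨g₂, hg₂⟩))
  have h2' : ∀ g : D.DeltaHat, (g : D.PiHat) ∈ (⁅D.DeltaHat, D.DeltaHat⁆).topologicalClosure →
      f.toMonoidHom g ∈ (⁅(⊤ : Subgroup Q), (⊤ : Subgroup Q)⁆ : Subgroup Q) :=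
    fun g hg => mem_of_coe_mem_map_subtype_comap f.toMonoidHom _ (h2 hg)
  -- `[[Δ_X, Δ_X], Δ_X]⁻ ⊆ f⁻¹ [[Q, Q], Q]`
  have h3 : (⁅⁅D.DeltaHat, D.DeltaHat⁆, D.DeltaHat⁆).topologicalClosure ≤
      ((⁅⁅(⊤ : Subgroup Q), (⊤ : Subgroup Q)⁆, (⊤ : Subgroup Q)⁆ : Subgroup Q).comap
        f.toMonoidHom).map D.DeltaHat.subtype := by
    refine Subgroup.topologicalClosure_minimal _ (Subgroup.commutator_le.mpr ?_)
      (isClosed_map_subtype_comap hΔclosed f.toMonoidHom hfc _)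
    intro c hc g hg
    have hc' : c ∈ D.DeltaHat := D.commutatorClosure_le_deltaHat (Subgroup.le_topologicalClosure _ hc)
    refine ⟨⁅(⟨c, hc'⟩ : D.DeltaHat), ⟨g, hg⟩⁆, ?_, rfl⟩
    rw [SetLike.mem_coe, Subgroup.mem_comap, map_commutatorElement]
    exact Subgroup.commutator_mem_commutator
      (h2' ⟨c, hc'⟩ (Subgroup.le_topologicalClosure _ hc)) (Subgroup.mem_top (f.toMonoidHom ⟨g, hg⟩))
  refine ⟨f.toMonoidHom, a, b, hfa, hfb, h2', fun g hg => ?_⟩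
  exact mem_of_coe_mem_map_subtype_comap f.toMonoidHom _ (h3 hg)

/-- `[ι y, ι y'] ∈ K₃ = [[Δ_X,Δ_X],Δ_X]⁻` for `y, y' ∈ Δ^tp_Y` when `(Δ^tp_Y)^Θ` is commutative: the
commutator `[y, y']` dies in `(Π^tp_X)^Θ`, whose kernel is `ι⁻¹ K₃` (p. 12).
[cite: MochizukiEtTh2009, §1 p.12] -/
theorem commutator_map_dtpY_le (hYab : ∀ x ∈ D.DtpYTheta, ∀ y ∈ D.DtpYTheta, x * y = y * x) :
    ⁅D.DtpY.map D.toHat.toMonoidHom, D.DtpY.map D.toHat.toMonoidHom⁆ ≤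
      (⁅⁅D.DeltaHat, D.DeltaHat⁆, D.DeltaHat⁆).topologicalClosure := by
  refine Subgroup.commutator_le.mpr ?_
  rintro _ ⟨y, hy, rfl⟩ _ ⟨y', hy', rfl⟩
  rw [← map_commutatorElement]
  have hker : (⁅y, y'⁆ : D.PiTemp) ∈ D.toTheta.ker := by
    rw [MonoidHom.mem_ker, map_commutatorElement, commutatorElement_eq_one_iff_mul_comm]
    exact hYab _ ⟨y, hy, rfl⟩ _ ⟨y', hy', rfl⟩
  rw [D.ker_toTheta] at hker
  exact hker

/-- Every `t ∈ Δ^tp_X` is `z₁^i · u` with `u ∈ Δ^tp_Y`, for `z₁ ∈ Δ^tp_X` with `toZ z₁ = 1`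
("`Δ^tp_X/Δ^tp_Y ≅ Z`", pp. 12, 16). [cite: MochizukiEtTh2009, §1 p.12] -/
theorem exists_eq_zpow_mul_of_mem_deltaTemp {z₁ : D.PiTemp} (hz₁ : z₁ ∈ D.DeltaTemp)
    (hz₁Z : D.toZ z₁ = Multiplicative.ofAdd 1) {t : D.PiTemp} (ht : t ∈ D.DeltaTemp) :
    ∃ i : ℤ, ∃ u ∈ D.DtpY, t = z₁ ^ i * u := by
  refine ⟨Multiplicative.toAdd (D.toZ t), (z₁ ^ Multiplicative.toAdd (D.toZ t))⁻¹ * t, ?_,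
    (mul_inv_cancel_left _ _).symm⟩
  refine ⟨?_, D.DeltaTemp.mul_mem (D.DeltaTemp.inv_mem (D.DeltaTemp.zpow_mem hz₁ _)) ht⟩
  change (z₁ ^ Multiplicative.toAdd (D.toZ t))⁻¹ * t ∈ D.toZ.ker
  rw [MonoidHom.mem_ker, map_mul, map_inv, map_zpow, hz₁Z, ← ofAdd_zsmul, smul_eq_mul, mul_one,
    ofAdd_toAdd, inv_mul_cancel]

/-- **Heisenberg surjectivity of the theta group, inside the profinite completion** ([EtTh] p. 12:
"`1 → ∧² Δ^ell_X (≅ Ẑ(1)) → Δ^Θ_X → Δ^ell_X → 1` … the image of `∧² Δ^ell_X` in `Δ^Θ_X` [is] `Δ_Θ`";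
p. 45 "the well-known structure of the theta-group"): if `(Δ^tp_Y)^Θ` is an abelian profinite group
(pp. 12–13; hypotheses `hYab` — commutativity — and `hYcl` — the image of `Δ^tp_Y` in
`Δ^Θ_X = Δ_X/[[Δ_X,Δ_X],Δ_X]⁻` is closed), then for every `z₁ ∈ Δ^tp_X` mapping to the generator
`1 ∈ Z` every element of `[Δ_X, Δ_X]⁻` is `ι[z₁, y] · k` with `y ∈ Δ^tp_Y` and
`k ∈ [[Δ_X,Δ_X],Δ_X]⁻`.  (Bilinearity of the commutator in the class-two quotient, density of
`Δ^tp_X` in `Δ_X`, compactness; no freeness of `Δ_X` is used.) [cite: MochizukiEtTh2009, §1 p.12] -/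
theorem exists_commutator_mul_of_mem_commutatorClosure
    (hYab : ∀ x ∈ D.DtpYTheta, ∀ y ∈ D.DtpYTheta, x * y = y * x)
    (hYcl : (D.DtpY.map D.toHat.toMonoidHom).topologicalClosure ≤
      D.DtpY.map D.toHat.toMonoidHom ⊔ (⁅⁅D.DeltaHat, D.DeltaHat⁆, D.DeltaHat⁆).topologicalClosure)
    {z₁ : D.PiTemp} (hz₁ : z₁ ∈ D.DeltaTemp) (hz₁Z : D.toZ z₁ = Multiplicative.ofAdd 1)
    {k : D.PiHat} (hk : k ∈ (⁅D.DeltaHat, D.DeltaHat⁆).topologicalClosure) :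
    ∃ y ∈ D.DtpY, ∃ k₃ ∈ (⁅⁅D.DeltaHat, D.DeltaHat⁆, D.DeltaHat⁆).topologicalClosure,
      k = D.toHat.toMonoidHom (z₁ * y * z₁⁻¹ * y⁻¹) * k₃ := by
  haveI : CompactSpace D.PiHat := D.isProfiniteCompletion_toHat.compactSpace
  haveI : T2Space D.PiHat := D.isProfiniteCompletion_toHat.t2Space
  haveI hΔn : D.DeltaHat.Normal := SettingCompletion.deltaHat_normal D.toTemperedCurve
  haveI hK₃n : (⁅⁅D.DeltaHat, D.DeltaHat⁆, D.DeltaHat⁆).topologicalClosure.Normal :=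
    Subgroup.is_normal_topologicalClosure _
  -- the class-two data `A = Δ_X ⊇ K₂ = [Δ_X,Δ_X]⁻`, `K₃ = [[Δ_X,Δ_X],Δ_X]⁻`
  have hΔclosed : IsClosed (D.DeltaHat : Set D.PiHat) := Subgroup.isClosed_topologicalClosure _
  have hAA : ⁅D.DeltaHat, D.DeltaHat⁆ ≤ (⁅D.DeltaHat, D.DeltaHat⁆).topologicalClosure :=
    Subgroup.le_topologicalClosure _
  have hK₂A : (⁅D.DeltaHat, D.DeltaHat⁆).topologicalClosure ≤ D.DeltaHat :=
    D.commutatorClosure_le_deltaHat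
  have hAK : ⁅D.DeltaHat, (⁅D.DeltaHat, D.DeltaHat⁆).topologicalClosure⁆ ≤
      (⁅⁅D.DeltaHat, D.DeltaHat⁆, D.DeltaHat⁆).topologicalClosure := by
    refine (commutator_topologicalClosure_right_le _ _).trans (le_of_eq ?_)
    rw [Subgroup.commutator_comm D.DeltaHat ⁅D.DeltaHat, D.DeltaHat⁆]
  have hK₃closed : IsClosed
      (((⁅⁅D.DeltaHat, D.DeltaHat⁆, D.DeltaHat⁆).topologicalClosure : Subgroup D.PiHat) :
        Set D.PiHat) :=
    Subgroup.isClosed_topologicalClosure _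
  -- `N = (ι Δ^tp_Y)⁻ ≤ Δ_X`, closed, abelian modulo `K₃`
  have hNYΔ : D.DtpY.map D.toHat.toMonoidHom ≤ D.DeltaHat :=
    (Subgroup.map_mono (inf_le_right : D.DtpY ≤ D.DeltaTemp)).trans
      (Subgroup.le_topologicalClosure _)
  have hNΔ : (D.DtpY.map D.toHat.toMonoidHom).topologicalClosure ≤ D.DeltaHat :=
    Subgroup.topologicalClosure_minimal _ hNYΔ hΔclosed
  have hNclosed : IsClosed
      (((D.DtpY.map D.toHat.toMonoidHom).topologicalClosure : Subgroup D.PiHat) : Set D.PiHat) :=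
    Subgroup.isClosed_topologicalClosure _
  have hNab : ⁅(D.DtpY.map D.toHat.toMonoidHom).topologicalClosure,
      (D.DtpY.map D.toHat.toMonoidHom).topologicalClosure⁆ ≤
      (⁅⁅D.DeltaHat, D.DeltaHat⁆, D.DeltaHat⁆).topologicalClosure := by
    have h1 : ⁅(D.DtpY.map D.toHat.toMonoidHom).topologicalClosure,
        D.DtpY.map D.toHat.toMonoidHom⁆ ≤
        (⁅⁅D.DeltaHat, D.DeltaHat⁆, D.DeltaHat⁆).topologicalClosure :=
      (commutator_topologicalClosure_left_le _ _).trans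
        (Subgroup.topologicalClosure_minimal _ (D.commutator_map_dtpY_le hYab) hK₃closed)
    exact (commutator_topologicalClosure_right_le _ _).trans
      (Subgroup.topologicalClosure_minimal _ h1 hK₃closed)
  -- `T = ι Δ^tp_X` is dense in `Δ_X` and contained in `ι(z₁)^ℤ · N`
  have hAT : (D.DeltaHat : Set D.PiHat) ⊆
      closure ((D.DeltaTemp.map D.toHat.toMonoidHom : Subgroup D.PiHat) : Set D.PiHat) := by
    rw [← Subgroup.topologicalClosure_coe]; rfl
  have hT : ∀ t ∈ D.DeltaTemp.map D.toHat.toMonoidHom, ∃ i : ℤ,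
      ∃ n ∈ (D.DtpY.map D.toHat.toMonoidHom).topologicalClosure,
        t = (D.toHat.toMonoidHom z₁) ^ i * n := by
    rintro _ ⟨d, hd, rfl⟩
    obtain ⟨i, u, hu, rfl⟩ := D.exists_eq_zpow_mul_of_mem_deltaTemp hz₁ hz₁Z hd
    exact ⟨i, D.toHat.toMonoidHom u, Subgroup.le_topologicalClosure _ ⟨u, hu, rfl⟩,
      by rw [map_mul, map_zpow]⟩
  -- the generic Heisenberg surjectivity
  obtain ⟨n, hn, k₃, hk₃, hkeq⟩ := exists_commutator_mul_of_mem_closure D.DeltaHat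
    (⁅D.DeltaHat, D.DeltaHat⁆).topologicalClosure
    (⁅⁅D.DeltaHat, D.DeltaHat⁆, D.DeltaHat⁆).topologicalClosure hAA hK₂A hAK hK₃closed
    (Subgroup.le_topologicalClosure _ ⟨z₁, hz₁, rfl⟩) _ hNΔ hNclosed hNab _ hAT hT _ hk
  -- `hYcl`: `n = ι y · k'` with `y ∈ Δ^tp_Y`, `k' ∈ K₃`
  obtain ⟨_, ⟨y, hy, rfl⟩, k', hk', rfl⟩ := Subgroup.mem_sup_of_normal_right.mp (hYcl hn)
  refine ⟨y, hy, D.toHat.toMonoidHom y * ⁅D.toHat.toMonoidHom z₁, k'⁆ *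
    (D.toHat.toMonoidHom y)⁻¹ * k₃, ?_, ?_⟩
  · refine Subgroup.mul_mem _ (hK₃n.conj_mem _ ?_ _) hk₃
    rw [commutatorElement_def]
    exact Subgroup.mul_mem _ (hK₃n.conj_mem _ hk' _) (Subgroup.inv_mem _ hk')
  · rw [hkeq, ← commutatorElement_def, map_commutatorElement]
    simp only [commutatorElement_def]
    group

/-- **Heisenberg surjectivity of the theta group** (same source): under `hYab`, `hYcl`, for every
`z₁ ∈ Δ^tp_X` with `toZ z₁ = 1` EVERY element of `Δ_Θ = Ker((Π^tp_X)^Θ ↠ (Π^tp_X)^ell)` is a single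
commutator `θ([z₁, y])` with `y ∈ Δ^tp_Y` — the map `Δ^tp_Y → Δ_Θ`, `y ↦ θ[z₁, y]`, is ONTO.
[cite: MochizukiEtTh2009, §1 p.12] -/
theorem exists_commutator_of_mem_deltaTheta
    (hYab : ∀ x ∈ D.DtpYTheta, ∀ y ∈ D.DtpYTheta, x * y = y * x)
    (hYcl : (D.DtpY.map D.toHat.toMonoidHom).topologicalClosure ≤
      D.DtpY.map D.toHat.toMonoidHom ⊔ (⁅⁅D.DeltaHat, D.DeltaHat⁆, D.DeltaHat⁆).topologicalClosure)
    {z₁ : D.PiTemp} (hz₁ : z₁ ∈ D.DeltaTemp) (hz₁Z : D.toZ z₁ = Multiplicative.ofAdd 1)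
    {s : D.GtpTheta} (hs : s ∈ D.DeltaTheta) :
    ∃ y ∈ D.DtpY, D.toTheta (z₁ * y * z₁⁻¹ * y⁻¹) = s := by
  haveI hΔn : D.DeltaHat.Normal := SettingCompletion.deltaHat_normal D.toTemperedCurve
  haveI hK₃n : (⁅⁅D.DeltaHat, D.DeltaHat⁆, D.DeltaHat⁆).topologicalClosure.Normal :=
    Subgroup.is_normal_topologicalClosure _
  -- `s = θ d` with `ι d ∈ K₂`
  obtain ⟨d, rfl⟩ := D.toTheta_surjective s
  have hdK₂ : D.toHat.toMonoidHom d ∈ (⁅D.DeltaHat, D.DeltaHat⁆).topologicalClosure := by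
    have hd : d ∈ (D.thetaToEll.comp D.toTheta).ker := hs
    rw [D.ker_toEll] at hd
    exact hd
  obtain ⟨y, hy, k₃, hk₃, hdeq⟩ :=
    D.exists_commutator_mul_of_mem_commutatorClosure hYab hYcl hz₁ hz₁Z hdK₂
  refine ⟨y, hy, ?_⟩
  have hmem : (z₁ * y * z₁⁻¹ * y⁻¹)⁻¹ * d ∈ D.toTheta.ker := by
    rw [D.ker_toTheta, Subgroup.mem_comap, map_mul, map_inv, ← QuotientGroup.eq, hdeq,
      QuotientGroup.mk_mul, (QuotientGroup.eq_one_iff _).mpr hk₃, mul_one]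
  rw [MonoidHom.mem_ker, map_mul, map_inv, inv_mul_eq_one] at hmem
  exact hmem

end ThetaSetting

end Literature.AnabelianGeometry.EtaleTheta

end
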